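import Mathlib
import Summits.NavierStokesRegularity.NavierStokesRegularity.Theorems.TaoLadderRungTwoFlatAheadCutStep
import HarnessLib

/-!
# AHEAD-TAIL-62, composition: the cut family from a SCALAR CUT SCHEDULE, hence the tail input (T1) of the core contract
  and the AHEAD clause one shell up, modulo the window readout (theory-1 g48 numT62 62.11–62.14; helper for the K_A♭ parent
  item stmt-NavierStokesRegularity-22987 `FlatGapCertificatesV2`, route TaoLadderRungTwoFlat; cell harvest/h2-tao-ladder, p1 g24;
  LADDER §62)

With the per-cut step PROVED (`HopTube.aheadCutStep`, …AheadCutStep), the cuts beyond the certificate window follow from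
scalar data only:

* `initialTail_le_of_clauses` — the initial tail energies from H(n)'s `AheadClause` (`8·w_k|z_k| ≤ r`, `k ≥ k₁`) and the kick
  ball (`w_k|S₀ − z| ≤ r`): `Σ_{m∈N} Σᵢ S₀(i,m)² ≤ 2·(9r/8)²·Ω` for every finite `N ⊆ (j, ∞)` with `Σ_{m∈N} w_m⁻² ≤ Ω`
  (`j + 1 ≥ k₁`);
* `aheadCuts_of_schedule` — a window-top hull `|S₁(k_A+1, ·)| ≤ V_top` on `[0, c₀]` (certificate readout E2), cut sizes
  `G_j ≥ 0` dominating the initial tails, and the scalar closing inequalities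
  `(4/3)c₀·clock_{k_A+1}·V_top(V_top + 2εG_{k_A+1}) < G_{k_A+1}`, `(4/3)c₀·clock_{j+1}·2G_j(2G_j + 2εG_{j+1}) < G_{j+1}`
  give EVERY cut `AheadCutBoundWith … n k (G k)`, `k > k_A` (`aheadCuts_of_step` with `aheadCutStep` at base and step,
  `boundary_of_cut` feeding `V_{j+1} := 2G_j`);
* `aheadTailWith_of_schedule` — hence (T1), LITERALLY the body of `HopTube.AheadTailWith … good n k_A BT` (…CoreContract; stated
  unfolded so that this module does not import …CoreContract), for `ω_k·2G_k ≤ BT` (`aheadTail_of_cuts`);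
* `aheadClause_of_schedule` — and the AHEAD clause of the recentred state at every good time from the window rows
  `k ∈ [k₁, k_H]` (`AheadWindowWith`) and the cuts `k > k_H` with `8·w_k·2G_k ≤ r·AFL` (`aheadClause_of_window_cuts`).

HONEST FRAMING: bookkeeping over MODEL-lattice certificate flows (graded mirror table on `S♭`); the window readouts
(`V_top`, `AheadWindowWith`), the cut schedule `G` and its inequalities are HYPOTHESES (desk sizes in theory-1's AHEAD-TAIL-62,
unsealed); nothing certified; no item closed; nothing about the Navier–Stokes equations.
-/

noncomputable section

-- the sub-problem namespace repeats the summit name by design (D-0017)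
set_option linter.dupNamespace false

namespace Summit.NavierStokesRegularity.NavierStokesRegularity.Theorems.HopTube

open Set Finset Literature.Analysis.FluidPDE Literature.Analysis.FluidPDE.TaoCascade MirrorPulse

/-- **Initial tail energies from the clauses of `H(n)`.** `AheadClause` (`8·w_k·|z_k| ≤ r` from `k₁` on) and the kick ball
(`w_k·|S₀ − z| ≤ r`) give `|S₀(i,m)| ≤ (9/8)·r/w_m` for `m ≥ k₁`, hence `Σ_{m∈N} Σᵢ S₀(i,m)² ≤ 2·(9r/8)²·Ω` for every finite
`N ⊆ (j, ∞)` (`j + 1 ≥ k₁`) whose weight tail `Σ_{m∈N} w_m⁻²` is at most `Ω`.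
[cite: Tao2016AveragedNS, §6.2 Prop. 6.3 (ix) (thin tails, statement shape); cell LADDER §62 (AHEAD-TAIL-62, initial tails)] -/
theorem initialTail_le_of_clauses (P : TubeSchedule) {w : ℤ → ℝ} {r : ℝ} {z S₀ : Fin 2 → ℤ → ℝ}
    (hw : ∀ k, 0 < w k) (hr : 0 ≤ r) (hahead : AheadClause P w r z) (hkick : ∀ i k, w k * |S₀ i k - z i k| ≤ r)
    {j : ℤ} (hj : (P.k₁ : ℤ) ≤ j + 1) {Ω : ℝ} {N : Finset ℤ} (hN : ∀ m ∈ N, j < m)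
    (hΩ : ∑ m ∈ N, (w m)⁻¹ ^ 2 ≤ Ω) :
    ∑ m ∈ N, ∑ i : Fin 2, S₀ i m ^ 2 ≤ 2 * (9 / 8 * r) ^ 2 * Ω := by
  have hsite : ∀ m ∈ N, ∀ i : Fin 2, S₀ i m ^ 2 ≤ (9 / 8 * r) ^ 2 * (w m)⁻¹ ^ 2 := by
    intro m hm i
    have hwm := hw m
    have hz : |z i m| ≤ r / (8 * w m) := by
      rw [le_div_iff₀ (by positivity)]
      have := hahead i m (by have := hN m hm; omega)
      linarith
    have hk : |S₀ i m - z i m| ≤ r / w m := by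
      rw [le_div_iff₀ hwm, mul_comm]; exact hkick i m
    have hS : |S₀ i m| ≤ 9 / 8 * r * (w m)⁻¹ := by
      have htri : |S₀ i m| ≤ |S₀ i m - z i m| + |z i m| := by
        have := abs_add_le (S₀ i m - z i m) (z i m); rwa [sub_add_cancel] at this
      have e : r / w m + r / (8 * w m) = 9 / 8 * r * (w m)⁻¹ := by field_simp; ring
      linarith [hk, hz, e]
    have h0 : 0 ≤ 9 / 8 * r * (w m)⁻¹ := by positivity
    calc S₀ i m ^ 2 = |S₀ i m| ^ 2 := (sq_abs _).symm
      _ ≤ (9 / 8 * r * (w m)⁻¹) ^ 2 := pow_le_pow_left₀ (abs_nonneg _) hS 2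
      _ = (9 / 8 * r) ^ 2 * (w m)⁻¹ ^ 2 := by ring
  calc ∑ m ∈ N, ∑ i : Fin 2, S₀ i m ^ 2 ≤ ∑ m ∈ N, (2 * ((9 / 8 * r) ^ 2 * (w m)⁻¹ ^ 2)) := by
        refine Finset.sum_le_sum fun m hm => ?_
        rw [Fin.sum_univ_two]
        linarith [hsite m hm 0, hsite m hm 1]
    _ = 2 * (9 / 8 * r) ^ 2 * ∑ m ∈ N, (w m)⁻¹ ^ 2 := by rw [Finset.mul_sum]; refine Finset.sum_congr rfl fun m _ => by ring
    _ ≤ 2 * (9 / 8 * r) ^ 2 * Ω := mul_le_mul_of_nonneg_left hΩ (by positivity)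

section Schedule

variable {ε ε₀ : ℝ} {P : TubeSchedule} {Bcl : ℕ → (Fin 2 → ℤ → ℝ) → Prop} {i₀ : Fin 2} {X₀ : Fin 2 → ℝ} {w : ℤ → ℝ}
  {r c₀ : ℝ} {ζ : ℕ → Fin 2 → ℤ → ℝ} {ustar : Fin 2 → ℤ → ℝ} {n : ℕ}

/-- **ALL CUTS FROM A SCALAR CUT SCHEDULE.** Window-top hull `V_top` at shell `k_A + 1` on `[0, c₀]`, cut sizes `G_j ≥ 0`
dominating the initial tail energies beyond every `j > k_A`, and the closing inequalities at the base (`V := V_top`) and along the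
step (`V_{j+1} := 2G_j`) give `AheadCutBoundWith … n k (G k)` for every `k > k_A`.
[cite: Tao2016AveragedNS, §6.2 Prop. 6.3 (ix), §4 (4.3); cell LADDER §62 (AHEAD-TAIL-62 62.13)] -/
theorem aheadCuts_of_schedule (hε : 0 ≤ ε) (hε₀ : 0 < ε₀) (hc₀ : 0 ≤ c₀) {kA : ℤ} {Vtop : ℝ} {G : ℤ → ℝ}
    (hVtop : 0 ≤ Vtop) (hG0 : ∀ j, kA < j → 0 ≤ G j)
    (hwin : ∀ z S₀ τ S F, HopPremiseWith P Bcl shiftSetFlat ε₀ i₀ (mirrorTable ε ε) X₀ w r c₀ ζ ustar n z S₀ τ S F →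
      ∀ t ∈ Icc 0 c₀, |S 1 (kA + 1) t| ≤ Vtop)
    (hinit : ∀ j, kA < j → ∀ z S₀ τ S F,
      HopPremiseWith P Bcl shiftSetFlat ε₀ i₀ (mirrorTable ε ε) X₀ w r c₀ ζ ustar n z S₀ τ S F →
        ∀ N : Finset ℤ, (∀ m ∈ N, j < m) → ∑ m ∈ N, ∑ i : Fin 2, S₀ i m ^ 2 ≤ G j ^ 2)
    (hclose0 : 4 / 3 * c₀ * clock ε₀ (kA + 1) * Vtop * (Vtop + 2 * ε * G (kA + 1)) < G (kA + 1))
    (hclose : ∀ j, kA + 1 ≤ j →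
      4 / 3 * c₀ * clock ε₀ (j + 1) * (2 * G j) * (2 * G j + 2 * ε * G (j + 1)) < G (j + 1)) :
    ∀ k, kA < k → AheadCutBoundWith P Bcl shiftSetFlat ε₀ i₀ (mirrorTable ε ε) X₀ w r c₀ ζ ustar n k (G k) := by
  refine aheadCuts_of_step ?_ ?_
  · exact aheadCutStep hε hε₀ hc₀ hVtop (hG0 (kA + 1) (by omega)) hwin (hinit (kA + 1) (by omega)) hclose0
  · intro j hj hcut
    have hGj : 0 ≤ G j := hG0 j (by omega)
    exact aheadCutStep hε hε₀ hc₀ (by positivity) (hG0 (j + 1) (by omega)) (boundary_of_cut hcut)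
      (hinit (j + 1) (by omega)) (hclose j hj)

/-- **(T1) FROM THE CUT SCHEDULE**: the tail input of the core contract (`coreLandingWith_of_window_tail`; the statement below is
literally the body of `HopTube.AheadTailWith … good n k_A BT`) from the data of `aheadCuts_of_schedule` and the gauge condition
`ω_k·2G_k ≤ BT` (`k > k_A`), for any `good` whose good times lie in `[0, c₀]`.
[cite: Tao2016AveragedNS, §6.2 Prop. 6.3 (ix); cell LADDER §62 (62.11 (T1), 62.13)] -/
theorem aheadTailWith_of_schedule (hε : 0 ≤ ε) (hε₀ : 0 < ε₀) (hc₀ : 0 ≤ c₀) (hg : 0 < P.g) (hb : 0 < P.b)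
    {good : ℕ → (Fin 2 → ℤ → ℝ → ℝ) → ℝ → Prop} {kA : ℤ} {Vtop BT : ℝ} {G : ℤ → ℝ}
    (hVtop : 0 ≤ Vtop) (hG0 : ∀ j, kA < j → 0 ≤ G j)
    (hwin : ∀ z S₀ τ S F, HopPremiseWith P Bcl shiftSetFlat ε₀ i₀ (mirrorTable ε ε) X₀ w r c₀ ζ ustar n z S₀ τ S F →
      ∀ t ∈ Icc 0 c₀, |S 1 (kA + 1) t| ≤ Vtop)
    (hinit : ∀ j, kA < j → ∀ z S₀ τ S F,
      HopPremiseWith P Bcl shiftSetFlat ε₀ i₀ (mirrorTable ε ε) X₀ w r c₀ ζ ustar n z S₀ τ S F →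
        ∀ N : Finset ℤ, (∀ m ∈ N, j < m) → ∑ m ∈ N, ∑ i : Fin 2, S₀ i m ^ 2 ≤ G j ^ 2)
    (hclose0 : 4 / 3 * c₀ * clock ε₀ (kA + 1) * Vtop * (Vtop + 2 * ε * G (kA + 1)) < G (kA + 1))
    (hclose : ∀ j, kA + 1 ≤ j →
      4 / 3 * c₀ * clock ε₀ (j + 1) * (2 * G j) * (2 * G j + 2 * ε * G (j + 1)) < G (j + 1))
    (hBT : ∀ (i : Fin 2) (k : ℤ), kA < k → geomGauge P.g P.b i k * (2 * G k) ≤ BT)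
    (hgood : ∀ z S₀ τ S F, HopPremiseWith P Bcl shiftSetFlat ε₀ i₀ (mirrorTable ε ε) X₀ w r c₀ ζ ustar n z S₀ τ S F →
      ∀ t, good n S t → t ∈ Icc 0 c₀) :
    ∀ z S₀ τ S F, HopPremiseWith P Bcl shiftSetFlat ε₀ i₀ (mirrorTable ε ε) X₀ w r c₀ ζ ustar n z S₀ τ S F →
      ∀ t, good n S t → ∀ (i : Fin 2) (k : ℤ), kA < k → geomGauge P.g P.b i k * |S i (1 + k) t| ≤ BT :=
  aheadTail_of_cuts hg hb (aheadCuts_of_schedule hε hε₀ hc₀ hVtop hG0 hwin hinit hclose0 hclose) hBT hgood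

/-- **THE AHEAD CLAUSE FROM THE WINDOW ROWS AND THE CUT SCHEDULE**: at every good time of hop `n` the recentred state
satisfies `AheadClause P w r (recentre S t (a S t))` (the `hcl` input of `tubeStepAheadWith_of_good`), given the window rows
`k ∈ [k₁, k_H]` (`AheadWindowWith`, ratio floor `AFL` factored), the cut data of `aheadCuts_of_schedule` from `k_H` on, the gauge
condition `8·w_k·2G_k ≤ r·AFL` (`k > k_H`) and `AFL ≤ a S t` at good times.
[cite: Tao2016AveragedNS, §6.2 Prop. 6.3 (ix); cell LADDER §62 (62.13 (4), 62.14)] -/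
theorem aheadClause_of_schedule (hε : 0 ≤ ε) (hε₀ : 0 < ε₀) (hc₀ : 0 ≤ c₀) (hr : 0 ≤ r) (hw : ∀ k, 0 ≤ w k)
    {good : ℕ → (Fin 2 → ℤ → ℝ → ℝ) → ℝ → Prop} {kH : ℤ} {Vtop AFL : ℝ} {G : ℤ → ℝ}
    {a : (Fin 2 → ℤ → ℝ → ℝ) → ℝ → ℝ} (hAFL : 0 < AFL)
    (hVtop : 0 ≤ Vtop) (hG0 : ∀ j, kH < j → 0 ≤ G j)
    (hwinA : AheadWindowWith P Bcl shiftSetFlat ε₀ i₀ (mirrorTable ε ε) X₀ w r c₀ ζ ustar good n kH AFL)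
    (hwin : ∀ z S₀ τ S F, HopPremiseWith P Bcl shiftSetFlat ε₀ i₀ (mirrorTable ε ε) X₀ w r c₀ ζ ustar n z S₀ τ S F →
      ∀ t ∈ Icc 0 c₀, |S 1 (kH + 1) t| ≤ Vtop)
    (hinit : ∀ j, kH < j → ∀ z S₀ τ S F,
      HopPremiseWith P Bcl shiftSetFlat ε₀ i₀ (mirrorTable ε ε) X₀ w r c₀ ζ ustar n z S₀ τ S F →
        ∀ N : Finset ℤ, (∀ m ∈ N, j < m) → ∑ m ∈ N, ∑ i : Fin 2, S₀ i m ^ 2 ≤ G j ^ 2)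
    (hclose0 : 4 / 3 * c₀ * clock ε₀ (kH + 1) * Vtop * (Vtop + 2 * ε * G (kH + 1)) < G (kH + 1))
    (hclose : ∀ j, kH + 1 ≤ j →
      4 / 3 * c₀ * clock ε₀ (j + 1) * (2 * G j) * (2 * G j + 2 * ε * G (j + 1)) < G (j + 1))
    (hGr : ∀ k, kH < k → 8 * (w k * (2 * G k)) ≤ r * AFL)
    (hgood : ∀ z S₀ τ S F, HopPremiseWith P Bcl shiftSetFlat ε₀ i₀ (mirrorTable ε ε) X₀ w r c₀ ζ ustar n z S₀ τ S F →
      ∀ t, good n S t → t ∈ Icc 0 c₀)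
    (ha : ∀ z S₀ τ S F, HopPremiseWith P Bcl shiftSetFlat ε₀ i₀ (mirrorTable ε ε) X₀ w r c₀ ζ ustar n z S₀ τ S F →
      ∀ t, good n S t → AFL ≤ a S t) :
    ∀ z S₀ τ S F, HopPremiseWith P Bcl shiftSetFlat ε₀ i₀ (mirrorTable ε ε) X₀ w r c₀ ζ ustar n z S₀ τ S F →
      ∀ t, good n S t → AheadClause P w r (recentre S t (a S t)) :=
  aheadClause_of_window_cuts hr hw hAFL hwinA (aheadCuts_of_schedule hε hε₀ hc₀ hVtop hG0 hwin hinit hclose0 hclose)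
    hGr hgood ha

end Schedule

end Summit.NavierStokesRegularity.NavierStokesRegularity.Theorems.HopTube

end
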